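import Literature.Computability.QuantumComplexity.PolyCopies
import Literature.Computability.Cryptography.LWEProofs
import HarnessLib

/-!
# Polynomially many parallel copies of a uniform quantum circuit family, V: the joint law of the copies is the i.i.d. product

Topic `Literature/Computability/QuantumComplexity`; sequel of `PolyCopies.lean` (the uniform
`K(n)`-copy family `PolyCopies.family P` of a Clifford+T family `F`: fan-out of the input, `K(n)`
verbatim copies of `F.circ n` on pairwise disjoint blocks; output kernel = Born sum of the product
state, `kernelProb_family_eq`; one-block marginals of the ANSWER wire, `sum_filter_blockState_wire0`).
There the copies are read only through their answer wires (boosting by majority, BBBV Thm. 4.13).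
For SAMPLING subroutines — a quantum sampler called `N = poly(n)` times on the same classical input,
as in Regev's reductions to the discrete Gaussian sampling problem (Regev 2009, Lemma 3.17: "call the
`DGS` oracle `n²` times with the pair `(L, rᵢ)`"; Lemma 3.20: "call the `DGS` oracle `N` times with
the lattice `L*` and the value `1/(100d)`") — the FULL output registers of the copies are needed,
and their joint law: this file proves that it is the `K(n)`-fold i.i.d. product of the output law
of `F` (Nielsen–Chuang 2010, §2.2.8: measuring a product state `⨂ⱼ ψⱼ` in the computational basis
yields independent outcomes, the `j`-th distributed as the measurement of `ψⱼ`).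

* `PolyCopies.copyStr P n j w` — the string read off the measured output `w` of the `K(n)`-copy
  family at the wires of copy `j` (positions `blk n j 0, …, blk n j (n + F.ancillas n − 1)`; the
  `b n − (n + F.ancillas n)` padding wires of the block are NOT read, so that `copyStr` is
  literally the output string of `F`, junk conventions of any decoder included);
  `copyStr_ofFn` (on a register: the restriction to the copy wires of block `j`).
* `PolyCopies.sum_ite_normSq_blockState` — the one-block marginal of ANY event of the copy
  register: `∑_v [T(v|copy)] ‖blockState v‖² = ∑_u [T u] ‖U_F |x,0⟩ (u)‖²` (`sum_normSq_placeGate_castLE`),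
  `= F.kernelProb x {ofFn u | T u}`.
* **`PolyCopies.kernel_map_copyStr`** — the law of the tuple of copy strings is
  `LWE.iidPMF (F.kernel x) (K n)`, the i.i.d. product `PMF` of the tree (`Cryptography/LWE.lean`,
  masses `∏ⱼ F.kernel x (sⱼ)` by `iidPMF_apply_holds`): Born weights of the product state factor
  (`sum_normSq_prodState_mul`, `Fintype.prod_sum`).
* `PolyCopies.kernelProb_copyStr_eq` — the same for probabilities of events of the tuple.

Everything here is PROVED (one definition with a body, `copyStr`; theorems).

## References

* M. A. Nielsen, I. L. Chuang, *Quantum Computation and Quantum Information*, CUP 2010, §2.2.5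
  (Born rule), §2.2.8 (composite systems: measurement statistics of product states)
  [NielsenChuang2010].
* C. H. Bennett, E. Bernstein, G. Brassard, U. Vazirani, *Strengths and weaknesses of quantum
  computing*, SIAM J. Comput. 26 (1997), Thm. 4.13–4.14 (independent copies / subroutine calls)
  [BennettBernsteinBrassardVazirani1997].
* O. Regev, *On lattices, learning with errors, random linear codes, and cryptography*, J. ACM 56
  (2009) = arXiv:2401.03703, Lemma 3.17 (p. 21), Lemma 3.20 (p. 22) [Regev2009].
-/

noncomputable section

namespace Literature.Computability.QuantumComplexity

namespace PolyCopies

open _root_.Computability Complexity Cryptography Function Matrix Finset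
open scoped ENNReal

variable (P : Params)

/-! ### The copy strings -/

/-- **The output string of copy `j`**, read off the measured output `w` of the `K(n)`-copy family on
inputs of length `n`: the bits at positions `blk n j 0, …, blk n j (n + F.ancillas n − 1)` (the wires
of the copy inside block `j`; the padding wires of the block are not read). [folklore] -/
def copyStr (n : ℕ) (j : ℕ) (w : List Bool) : List Bool :=
  List.ofFn fun i : Fin (n + P.F.ancillas n) => w.getD (blk P n j i) false

variable {P}

/-- The length of a copy string. [folklore] -/
@[simp] theorem length_copyStr (n j : ℕ) (w : List Bool) : (copyStr P n j w).length = n + P.F.ancillas n := by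
  simp [copyStr]

/-- **On a measured register, the copy string of block `j` is the restriction of the register to the
copy wires of block `j`.** [folklore] -/
theorem copyStr_ofFn (x : List Bool) (z : QReg (x.length + anc P x.length)) (j : Fin (K P x.length)) :
    copyStr P x.length j (List.ofFn z) =
      List.ofFn ((z ∘ blockEmb P x.length j) ∘ Fin.castLEEmb (copy_fits x.length)) := by
  unfold copyStr
  congr 1
  funext i
  have hlt : blk P x.length j i < x.length + anc P x.length :=
    blk_fits j.isLt (lt_of_lt_of_le i.isLt (copy_fits x.length))
  rw [List.getD_eq_getElem?_getD, List.getElem?_ofFn, dif_pos hlt, Option.getD_some]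
  rfl

/-! ### One-block marginals of arbitrary copy events -/

/-- **The one-block marginal of an event of the copy register**: for every predicate `T` on the
register of the copy, `∑_v [T (v|copy)] ‖blockState v‖² = ∑_u [T u] ‖(U_{F} |x, 0⟩)(u)‖²` (the
padding wires of the block stay `0` and carry no weight). [cite: NielsenChuang2010, §2.2.8 (measurement of one register of a product state)] -/
theorem sum_ite_normSq_blockState (x : List Bool) (T : QReg (x.length + P.F.ancillas x.length) → Prop) [DecidablePred T] :
    (∑ v : QReg (b P x.length), if T (v ∘ Fin.castLEEmb (copy_fits x.length)) then ‖blockState P x v‖ ^ 2 else 0) =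
      ∑ u : QReg (x.length + P.F.ancillas x.length),
        if T u then ‖(P.F.circ x.length).runOn 0 (basisState (padInput x.get (P.F.ancillas x.length))) u‖ ^ 2 else 0 := by
  simp only [blockState, Cpad, toMatrix_mapWires]
  rw [sum_normSq_placeGate_castLE (copy_fits x.length) ((P.F.circ x.length).toMatrix 0) (padBlock P x) T,
    padBlock_comp_castLE]
  refine Finset.sum_congr rfl fun u _ => ?_
  simp only [QCircuit.runOn, mulVec_basisState]

/-- **… equals the kernel probability of the given family**: `∑_v [T (v|copy)] ‖blockState v‖² =
Pr_{w ∼ F.kernel x}[w = ofFn u, T u]`, here for the event "the output string is `s`".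
[cite: NielsenChuang2010, §2.2.5 (Born rule)] -/
theorem sum_ite_normSq_blockState_eq_toReal (x : List Bool) (s : List Bool) :
    (∑ v : QReg (b P x.length), if List.ofFn (v ∘ Fin.castLEEmb (copy_fits x.length)) = s then ‖blockState P x v‖ ^ 2 else 0) =
      (P.F.kernel 0 x s).toReal := by
  classical
  rw [sum_ite_normSq_blockState x (fun u => List.ofFn u = s)]
  have h := toReal_outputPMF_map_ofFn (A := 0) (P.F.circ x.length) x.get ({s} : Set (List Bool))
  rw [← PMF.toOuterMeasure_apply_singleton]
  change _ = ((((P.F.circ x.length).outputPMF 0 x.get).map List.ofFn).toOuterMeasure {s}).toReal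
  rw [h]
  refine Finset.sum_congr rfl fun u _ => ?_
  simp only [Set.mem_singleton_iff]

/-! ### The joint law of the copies -/

/-- **The copies are independent and identically distributed**: the law of the tuple of the
`K(n)` copy strings of the `K(n)`-copy family run on `x` is the `K(n)`-fold i.i.d. product of the
output law `F.kernel x` of the given family ("measurement of `⨂ⱼ ψⱼ` gives outcome `(s₀, …, s_{K-1})`
with probability `∏ⱼ |⟨sⱼ|ψⱼ⟩|²`"). Proof: the output kernel is the Born sum of the product state
(`kernelProb_family_eq` / `runOn_circ`), the indicator of "every copy string is prescribed" is a
function of the block contents, the Born weights of a product state factor over the blocks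
(`sum_normSq_prodState_mul`), the sum over block contents of a product is the product of the block
sums (`Fintype.prod_sum`), and each block sum is `F.kernel x (sⱼ)`
(`sum_ite_normSq_blockState_eq_toReal`). [cite: NielsenChuang2010, §2.2.8 (measurement statistics of product states)] -/
theorem kernel_map_copyStr (x : List Bool) :
    ((family P).kernel 0 x).map (fun w => fun j : Fin (K P x.length) => copyStr P x.length j w) =
      LWE.iidPMF (P.F.kernel 0 x) (K P x.length) := by
  classical
  ext s
  rw [LWE.iidPMF_apply_holds]
  -- the left-hand side as a finite Born sum
  have hout := @QCircuit.outputPMF_apply_holds cliffordT x.length (anc P x.length) cliffordT_isUnitary_holds 0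
    (circ P x.length) x.get
  change (((((circ P x.length).outputPMF 0 x.get).map List.ofFn).map fun w => fun j : Fin (K P x.length) =>
      copyStr P x.length j w) s) = _
  rw [PMF.map_comp, PMF.map_apply, tsum_fintype]
  simp only [Function.comp_apply]
  suffices key : (∑ z : QReg (x.length + anc P x.length),
      (if s = (fun j : Fin (K P x.length) => copyStr P x.length j (List.ofFn z)) then
        (circ P x.length).outputPMF 0 x.get z else 0)) = ∏ j, P.F.kernel 0 x (s j) by
    convert key
  have hterm : ∀ z : QReg (x.length + anc P x.length),
      (if s = (fun j : Fin (K P x.length) => copyStr P x.length j (List.ofFn z)) then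
          (circ P x.length).outputPMF 0 x.get z else 0) =
        ENNReal.ofReal (‖prodState (blockEmb P x.length) (fun _ => blockState P x) (W1 P x) z‖ ^ 2 *
          ∏ j : Fin (K P x.length), if List.ofFn ((z ∘ blockEmb P x.length j) ∘ Fin.castLEEmb (copy_fits x.length)) = s j
            then (1 : ℝ) else 0) := by
    intro z
    rw [Finset.prod_boole]
    by_cases hs : ∀ j : Fin (K P x.length), List.ofFn ((z ∘ blockEmb P x.length j) ∘ Fin.castLEEmb (copy_fits x.length)) = s j
    · have hs' : s = fun j : Fin (K P x.length) => copyStr P x.length j (List.ofFn z) :=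
        funext fun j => by rw [copyStr_ofFn]; exact (hs j).symm
      rw [if_pos hs', if_pos (by simpa using hs), mul_one, hout, QCircuit.runOn, ← runOn_circ]
      rfl
    · have hs' : ¬ s = fun j : Fin (K P x.length) => copyStr P x.length j (List.ofFn z) := by
        intro h
        exact hs fun j => by rw [← copyStr_ofFn, h]
      rw [if_neg hs', if_neg (by simpa using hs), mul_zero, ENNReal.ofReal_zero]
  rw [Finset.sum_congr rfl fun z _ => hterm z, ← ENNReal.ofReal_sum_of_nonneg fun z _ =>
    mul_nonneg (sq_nonneg _) (Finset.prod_nonneg fun j _ => by split_ifs <;> norm_num)]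
  -- factor the Born weights of the product state over the blocks
  rw [sum_normSq_prodState_mul blockDisjoint (fun _ => blockState P x) (W1 P x)
    (fun y => ∏ j : Fin (K P x.length), if List.ofFn (y j ∘ Fin.castLEEmb (copy_fits x.length)) = s j then (1 : ℝ) else 0)]
  have hfac : (∑ y : Fin (K P x.length) → QReg (b P x.length),
      (∏ j, ‖blockState P x (y j)‖ ^ 2) *
        ∏ j, (if List.ofFn (y j ∘ Fin.castLEEmb (copy_fits x.length)) = s j then (1 : ℝ) else 0)) =
      ∏ j : Fin (K P x.length), ∑ v : QReg (b P x.length),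
        (if List.ofFn (v ∘ Fin.castLEEmb (copy_fits x.length)) = s j then ‖blockState P x v‖ ^ 2 else 0) := by
    rw [Fintype.prod_sum]
    refine Finset.sum_congr rfl fun y _ => ?_
    rw [← Finset.prod_mul_distrib]
    refine Finset.prod_congr rfl fun j _ => ?_
    split_ifs <;> simp
  rw [hfac]
  simp_rw [sum_ite_normSq_blockState_eq_toReal]
  rw [← ENNReal.toReal_prod, ENNReal.ofReal_toReal]
  exact ENNReal.prod_ne_top fun j _ => PMF.apply_ne_top _ _

/-- **Probabilities of events of the copy strings** are those of the i.i.d. product law.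
[cite: NielsenChuang2010, §2.2.8 (measurement statistics of product states)] -/
theorem kernelProb_copyStr_eq (x : List Bool) (T : Set (Fin (K P x.length) → List Bool)) :
    (family P).kernelProb 0 x {w | (fun j : Fin (K P x.length) => copyStr P x.length j w) ∈ T} =
      ((LWE.iidPMF (P.F.kernel 0 x) (K P x.length)).toOuterMeasure T).toReal := by
  rw [← kernel_map_copyStr, PMF.toOuterMeasure_map_apply]
  rfl

end PolyCopies

end Literature.Computability.QuantumComplexity

end
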